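import Literature.NumberTheory.GelbartRogawski1991.UnitaryDualPairSeesawConjSplittingLeft
import HarnessLib

/-!
# The splitting transported along a rational isometry of the first member IS COMPATIBLE

Topic `NumberTheory/GelbartRogawski1991`; namespace `Literature.NumberTheory.GelbartRogawski1991.UnitaryDualPair` (sequel of
`UnitaryDualPairSeesawConjSplittingLeft`; same setting and binders).  One `def` with body (`transportedSplittingLeft`, a homomorphism)
and theorems; no named facts, no `sorry`.

* `mem_range_ratSection_of_mem_adelicMpTheta` — range form of Weil's uniqueness: a `Θ`-fixing element of `Mp_ψ(𝕎_𝔸)ᶜᵒⁿᵗ` over a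
  RATIONAL point of `Sp(𝕎_𝔸)` is a value of [GelbartRogawski1991]'s section `i = ratSection` (`thetaFixing_unique`, `range_ratSection_eq`);
* `transportedSplittingLeft := reindex_e ∘ seesawConjSplittingLeft : U(J_V′ ⊗ J_W)(𝔸_F) →* Mp_ψ(𝕎_{adelicGram e T_V′ T_W})ᶜᵒⁿᵗ`,
  `proj_transportedSplittingLeft` (`π ∘ s′ = ι′`), `coe_transportedSplittingLeft_mem_adelicMpTheta` (`Θ`-fixing at rational points),
  **`isCompatible_transportedSplittingLeft`** — `s′` is a COMPATIBLE splitting of the `(J_V′, J_W)`-datum of record (both clauses of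
  [GelbartRogawski1991, Prop. 3.1.1]); and the operator identity `omega_ratLift_omega_transportedSplittingLeft`:
  `ω(r_F h₀) (R_e⁻¹ (ω(s′ p′) (R_e Ψ))) = R_e⁻¹ (ω(s ((a ⊗ 1) p′ (a ⊗ 1)⁻¹)) (R_e (ω(r_F h₀) Ψ)))`, `R_e = piSBReindex F e`.
No continuity is claimed for `s′`.

## References
* [GelbartRogawski1991] S. Gelbart, J. Rogawski, Invent. Math. 105 (1991), §3.1 Prop. 3.1.1 p. 455 L1–3, Remark p. 457 L4, p. 454 L40–42.
* [Weil1964] A. Weil, Acta Math. 111 (1964), Chap. III n° 40 p. 190, n° 41 Théorème 6 p. 193.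
* [Kudla1984] S. Kudla, *Seesaw dual reductive pairs*, Progr. Math. 46 (1984), §1.
* [MoeglinVignerasWaldspurger1987] C. Mœglin, M.-F. Vignéras, J.-L. Waldspurger, LNM 1291 (1987), Chap. 2 II.1.
-/

set_option autoImplicit false

noncomputable section

open scoped Matrix Kronecker
open NumberField
open Literature.RepresentationTheory.HeisenbergGroup
open Literature.RepresentationTheory.HeisenbergGroup.SymplecticMatrix (transportSp mapHom)
open Literature.NumberTheory.Automorphic
open Literature.NumberTheory.Automorphic.UnitaryGroup
open Literature.NumberTheory.Weil1964

namespace Literature.NumberTheory.GelbartRogawski1991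

namespace UnitaryDualPair

section Transport

variable (F E : Type) [Field F] [NumberField F] [Field E] [NumberField E] [Algebra F E]
variable (c : E ≃ₐ[F] E) (N M : ℕ) {n : ℕ} (e : Fin N × Fin M ≃ Fin n)
variable (JV JV' : Matrix (Fin N) (Fin N) E) (JW : Matrix (Fin M) (Fin M) E)
variable {TV TV' : Matrix (Fin N) (Fin N) F} {TW : Matrix (Fin M) (Fin M) F}

variable [Algebra.IsQuadraticExtension F E] {δ : E} (hcδ : c δ = -δ) (hδ : δ ≠ 0) {d : F}
  (hd : δ * δ = algebraMap F E d) (hV : TV.IsSymm) (hV' : TV'.IsSymm) (hW : TW.IsSymm)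
  (hVd : IsUnit TV.det) (hV'd : IsUnit TV'.det) (hWd : IsUnit TW.det)
  (hT : IsUnit (TV.map (algebraMap F (AdeleRing (𝓞 F) F)) ⊗ₖ TW.map (algebraMap F (AdeleRing (𝓞 F) F))).det)
  (hJV : JV = TV.map (algebraMap F E)) (hJV' : JV' = TV'.map (algebraMap F E)) (hJW : JW = TW.map (algebraMap F E))
  {s : adelicPair F E c N M JV JW →* adelicMpCont F (Fin n) (adelicGram F e TV TW)}
  {a : GL (Fin N) (AdeleRing (𝓞 E) E)} {a₀ : GL (Fin N) E}
  (haa₀ : (a : Matrix (Fin N) (Fin N) (AdeleRing (𝓞 E) E)) =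
    ((a₀ : GL (Fin N) E) : Matrix (Fin N) (Fin N) E).map (algebraMap E (AdeleRing (𝓞 E) E)))
  (ha : ((a : Matrix (Fin N) (Fin N) (AdeleRing (𝓞 E) E)).map (conjAdele F E c))ᵀ * adelicForm E N JV * a =
    adelicForm E N JV')
  {C : GL (Fin N × Fin M) (AdeleRing (𝓞 F) F)} {C₀ : GL (Fin N × Fin M) F}
  (hCC₀ : (C : Matrix (Fin N × Fin M) (Fin N × Fin M) (AdeleRing (𝓞 F) F)) =
    ((C₀ : GL (Fin N × Fin M) F) : Matrix (Fin N × Fin M) (Fin N × Fin M) F).map (algebraMap F (AdeleRing (𝓞 F) F)))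
  (hC : TV.map (algebraMap F (AdeleRing (𝓞 F) F)) ⊗ₖ TW.map (algebraMap F (AdeleRing (𝓞 F) F)) *
      (C : Matrix (Fin N × Fin M) (Fin N × Fin M) (AdeleRing (𝓞 F) F)) =
    TV'.map (algebraMap F (AdeleRing (𝓞 F) F)) ⊗ₖ TW.map (algebraMap F (AdeleRing (𝓞 F) F)))

/-! ## §3 Back to the datum of record along `e`: the transported splitting is COMPATIBLE -/

/-- **Range form of Weil's uniqueness**: a `Θ`-fixing element of `Mp_ψ(𝕎_𝔸)ᶜᵒⁿᵗ` lying over a RATIONAL point of `Sp(𝕎_𝔸)` is a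
value of [GR91]'s section `i = ratSection` (`thetaFixing_unique` + `range_ratSection_eq`). [cite: Weil1964, Chap. III n° 41 Thm 6 p. 193] [cite: GelbartRogawski1991, §3.1 p. 454 L40–42] -/
theorem mem_range_ratSection_of_mem_adelicMpTheta {m : ℕ} (T : Matrix (Fin m) (Fin m) (AdeleRing (𝓞 F) F))
    (hTu : IsUnit T.det) (p : adelicMpCont F (Fin m) T) (hp : (p : adelicMp F (Fin m) T) ∈ adelicMpTheta F (Fin m) T)
    (hproj : adelicMpCont.proj F (Fin m) T p ∈ (ratSp F T hTu).range) : p ∈ (ratSection F T hTu).range := by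
  -- term-mode (edition 2, A-p06 g12): no `rw` under the `Mp_ψ` instances, explicit `MonoidHom.mem_range` — the v1 proof
  -- exceeded the B30 160 k margin (A-p01 (g7) O5 pre-audit 2026-08-29), this one elaborates well inside it.
  obtain ⟨γ, hγ⟩ := MonoidHom.mem_range.1 hproj
  exact mem_range_ratSection_of_mem_range_ratThetaLiftCont F T hTu
    (MonoidHom.mem_range.2
      ⟨γ, (thetaFixing_unique F (Fin m) T hTu hp (coe_ratThetaLiftCont_mem_adelicMpTheta F T hTu γ)
        (hγ.symm.trans (proj_ratThetaLiftCont F T hTu γ).symm)).symm⟩)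

include hVd hWd hT haa₀ hCC₀ in
/-- **THE TRANSPORTED SPLITTING OF THE `(J_V′, J_W)`-DATUM OF RECORD**: `reindex_e ∘ seesawConjSplittingLeft :
U(J_V′ ⊗ J_W)(𝔸_F) →* Mp_ψ(𝕎_{adelicGram e T_V′ T_W})ᶜᵒⁿᵗ`. [cite: Weil1964, Chap. III n° 40 p. 190] [cite: Kudla1984, §1] -/
def transportedSplittingLeft :
    adelicPair F E c N M JV' JW →* adelicMpCont F (Fin n) (adelicGram F e TV' TW) :=
  (adelicMpContReindex F e
      (TV'.map (algebraMap F (AdeleRing (𝓞 F) F)) ⊗ₖ TW.map (algebraMap F (AdeleRing (𝓞 F) F)))).toMonoidHom.comp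
    (seesawConjSplittingLeft F E c N M e JV JV' JW hcδ hδ hd hV hV' hW hVd hWd hT hJV hJV' hJW haa₀ ha hCC₀ hC (s := s))

/-- Unfolding. [cite: Weil1964, Chap. III n° 40 p. 190] -/
theorem transportedSplittingLeft_apply (p : adelicPair F E c N M JV' JW) :
    transportedSplittingLeft F E c N M e JV JV' JW hcδ hδ hd hV hV' hW hVd hWd hT hJV hJV' hJW haa₀ ha hCC₀ hC (s := s) p =
      adelicMpContReindex F e
        (TV'.map (algebraMap F (AdeleRing (𝓞 F) F)) ⊗ₖ TW.map (algebraMap F (AdeleRing (𝓞 F) F)))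
        (seesawConjSplittingLeft F E c N M e JV JV' JW hcδ hδ hd hV hV' hW hVd hWd hT hJV hJV' hJW haa₀ ha hCC₀ hC
          (s := s) p) :=
  rfl

/-- **`π ∘ s′ = ι′`** for the transported splitting: `π(s′ p′) = toSp_{(J_V′, J_W), e}(p′)`. [cite: GelbartRogawski1991, §3.1 Prop. 3.1.1 p. 455 L1–3] -/
theorem proj_transportedSplittingLeft
    (hs : (splittingDatum F E c N M e JV JW hcδ hδ hd hV hW hVd hWd hJV hJW).IsCompatible s)
    (p : adelicPair F E c N M JV' JW) :
    adelicMpCont.proj F (Fin n) (adelicGram F e TV' TW)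
        (transportedSplittingLeft F E c N M e JV JV' JW hcδ hδ hd hV hV' hW hVd hWd hT hJV hJV' hJW haa₀ ha hCC₀ hC
          (s := s) p) =
      toSp F E c N M e JV' JW hcδ hδ hd hV' hW hJV' hJW p :=
  (adelicMpCont.proj_reindex F e _
      (seesawConjSplittingLeft F E c N M e JV JV' JW hcδ hδ hd hV hV' hW hVd hWd hT hJV hJV' hJW haa₀ ha hCC₀ hC
        (s := s) p)).trans
    (congrArg (spReindex e _)
      (proj_seesawConjSplittingLeft F E c N M e JV JV' JW hcδ hδ hd hV hV' hW hVd hWd hT hJV hJV' hJW haa₀ ha hCC₀ hC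
        hs p))

/-- **`Θ`-FIXING AT RATIONAL POINTS** for the transported splitting. [cite: Weil1964, Chap. III n° 41 Thm 6 p. 193] -/
theorem coe_transportedSplittingLeft_mem_adelicMpTheta
    (hs : (splittingDatum F E c N M e JV JW hcδ hδ hd hV hW hVd hWd hJV hJW).IsCompatible s)
    (ha₀ : (((a₀ : GL (Fin N) E) : Matrix (Fin N) (Fin N) E).map (c : E →+* E))ᵀ * JV * a₀ = JV')
    {p : adelicPair F E c N M JV' JW} (hp : p ∈ (rationalPairToAdelic F E c N M JV' JW).range) :
    ((transportedSplittingLeft F E c N M e JV JV' JW hcδ hδ hd hV hV' hW hVd hWd hT hJV hJV' hJW haa₀ ha hCC₀ hC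
          (s := s) p : adelicMpCont F (Fin n) (adelicGram F e TV' TW)) : adelicMp F (Fin n) (adelicGram F e TV' TW)) ∈
      adelicMpTheta F (Fin n) (adelicGram F e TV' TW) :=
  (coe_adelicMpContReindex_mem_adelicMpTheta_iff F e _ _).2
    (coe_seesawConjSplittingLeft_mem_adelicMpTheta F E c N M e JV JV' JW hcδ hδ hd hV hV' hW hVd hWd hT hJV hJV' hJW
      haa₀ ha hCC₀ hC hs ha₀ hp)

include hV'd in
/-- **THE TRANSPORTED SPLITTING IS COMPATIBLE** ([GR91, Prop. 3.1.1]: `π ∘ s′ = ι′` and `s′(G₁′(F)) ⊆ i(Sp_F(𝕎′))`) for the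
`(J_V′, J_W)`-datum of record — so the carriers `omegaAtLine … (hs′) …` / `finPairRep … hs′` of the transported splitting exist.
[cite: GelbartRogawski1991, §3.1 Prop. 3.1.1 p. 455 L1–3; Remark p. 457 L4] [cite: Weil1964, Chap. III n° 41 Thm 6 p. 193] -/
theorem isCompatible_transportedSplittingLeft
    (hs : (splittingDatum F E c N M e JV JW hcδ hδ hd hV hW hVd hWd hJV hJW).IsCompatible s)
    (ha₀ : (((a₀ : GL (Fin N) E) : Matrix (Fin N) (Fin N) E).map (c : E →+* E))ᵀ * JV * a₀ = JV') :
    (splittingDatum F E c N M e JV' JW hcδ hδ hd hV' hW hV'd hWd hJV' hJW).IsCompatible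
      (transportedSplittingLeft F E c N M e JV JV' JW hcδ hδ hd hV hV' hW hVd hWd hT hJV hJV' hJW haa₀ ha hCC₀ hC
        (s := s)) := by
  refine ⟨fun p => ?_, fun γ hγ => ?_⟩
  · exact proj_transportedSplittingLeft F E c N M e JV JV' JW hcδ hδ hd hV hV' hW hVd hWd hT hJV hJV' hJW haa₀ ha hCC₀
      hC hs p
  · refine mem_range_ratSection_of_mem_adelicMpTheta F _ _ _
      (coe_transportedSplittingLeft_mem_adelicMpTheta F E c N M e JV JV' JW hcδ hδ hd hV hV' hW hVd hWd hT hJV hJV' hJW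
        haa₀ ha hCC₀ hC hs ha₀ hγ) ?_
    rw [proj_transportedSplittingLeft F E c N M e JV JV' JW hcδ hδ hd hV hV' hW hVd hWd hT hJV hJV' hJW haa₀ ha hCC₀ hC
      hs γ]
    exact toSp_mem_range_ratSp F E c N M e JV' JW hcδ hδ hd hV' hW hV'd hWd hJV' hJW γ hγ

/-- **THE OPERATOR IDENTITY of the transported splitting**:
`ω(r_F h₀) (R_e⁻¹ (ω(s′ p′) (R_e Ψ))) = R_e⁻¹ (ω(s ((a ⊗ 1) p′ (a ⊗ 1)⁻¹)) (R_e (ω(r_F h₀) Ψ)))` in Kronecker coordinates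
(`R_e = piSBReindex F e`; `omega_apply_omega_ratConjSplitting` + the two reindexings of record).
[cite: Weil1964, Chap. III n° 40 p. 190] [cite: MoeglinVignerasWaldspurger1987, Chap. 2 II.1] -/
theorem omega_ratLift_omega_transportedSplittingLeft (p : adelicPair F E c N M JV' JW)
    (Ψ : piSchwartzBruhat F (Fin N × Fin M)) :
    adelicMpCont.omega F (Fin N × Fin M) _
        (ratPointsThetaLiftCont F (Fin N × Fin M) _ hT
          ⟨seesawElementLeft F E c N M JV JV' JW hcδ hδ hd hV hV' hW hJV hJV' hJW ha hC,
            seesawElementLeft_mem_range F E c N M JV JV' JW hcδ hδ hd hV hV' hW hVd hWd hT hJV hJV' hJW haa₀ ha hCC₀ hC⟩)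
        ((piSBReindex F e).symm
          (adelicMpCont.omega F (Fin n) (adelicGram F e TV' TW)
            (transportedSplittingLeft F E c N M e JV JV' JW hcδ hδ hd hV hV' hW hVd hWd hT hJV hJV' hJW haa₀ ha hCC₀ hC
              (s := s) p)
            (piSBReindex F e Ψ))) =
      (piSBReindex F e).symm
        (adelicMpCont.omega F (Fin n) (adelicGram F e TV TW) (s (adelicPairIsometryConjLeft F E c N M a ha p))
          (piSBReindex F e
            (adelicMpCont.omega F (Fin N × Fin M) _
              (ratPointsThetaLiftCont F (Fin N × Fin M) _ hT
                ⟨seesawElementLeft F E c N M JV JV' JW hcδ hδ hd hV hV' hW hJV hJV' hJW ha hC,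
                  seesawElementLeft_mem_range F E c N M JV JV' JW hcδ hδ hd hV hV' hW hVd hWd hT hJV hJV' hJW haa₀ ha hCC₀
                    hC⟩)
              Ψ))) := by
  -- (A) strip the two reindexings of record
  have hA : (piSBReindex F e).symm
        (adelicMpCont.omega F (Fin n) (adelicGram F e TV' TW)
          (transportedSplittingLeft F E c N M e JV JV' JW hcδ hδ hd hV hV' hW hVd hWd hT hJV hJV' hJW haa₀ ha hCC₀ hC
            (s := s) p)
          (piSBReindex F e Ψ)) =
      adelicMpCont.omega F (Fin N × Fin M) _
        (seesawConjSplittingLeft F E c N M e JV JV' JW hcδ hδ hd hV hV' hW hVd hWd hT hJV hJV' hJW haa₀ ha hCC₀ hC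
          (s := s) p) Ψ :=
    ((congrArg (piSBReindex F e).symm
        (adelicMpCont.omega_reindex_apply F e _
          (seesawConjSplittingLeft F E c N M e JV JV' JW hcδ hδ hd hV hV' hW hVd hWd hT hJV hJV' hJW haa₀ ha hCC₀ hC
            (s := s) p) (piSBReindex F e Ψ))).trans
      ((piSBReindex F e).symm_apply_apply _)).trans
      (congrArg (adelicMpCont.omega F (Fin N × Fin M) _ _) ((piSBReindex F e).symm_apply_apply Ψ))
  -- (B) conjugation by `r_F(h₀)`, (C) the reindexed original splitting
  exact (congrArg (adelicMpCont.omega F (Fin N × Fin M) _ _) hA).trans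
    ((omega_apply_omega_ratConjSplitting F (Fin N × Fin M) hT _ _ C hC _ p Ψ).trans
      (omega_seesawPairConjLeft_apply F E c N M e JV JV' JW s a ha p _))

end Transport

end UnitaryDualPair

end Literature.NumberTheory.GelbartRogawski1991

end
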